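import Mathlib
import Literature.AlgebraicGeometry.HodgeTheory.BlochSemiregularSpread
import Literature.AlgebraicGeometry.Dimension.PointDimension
import HarnessLib

/-!
# Crux `BlochSpreadEightFour` (stmt-HodgeConjecture-18884), line `bloch-lifts-fulton` — registered stub
# `stub_codimOfRegularImmersion`: an integral regular immersion of codimension `p` has its generic
# point in codimension exactly `p`

Routes `EightfoldBlochSeeds` / `EightfoldTwistedSheafSeeds` of `HodgeConjecture` (shared crux item
stmt-HodgeConjecture-18884, skeleton `Cruxes/BlochSpreadEightFour/Lines/bloch_lifts_fulton.lean`). The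
stub supplies the binder `∃ z, codim (i z) = p` of the glue theorem
`Theorems.HeckePrymWeilLine.semiregularSpread_of_blochLifts_of_fulton`, which the crux
`BlochSemiregularSpread (2 * 4) 4` does not carry.

MATHEMATICS (Matsumura, Thm. 17.4 with Krull's height theorem, Thm. 13.5). Let `X` be a locally
Noetherian scheme, `Z` an INTEGRAL scheme and `i : Z ⟶ X` a regular immersion of codimension `p` in the
tree's sense (`IsRegularImmersionOfCodim i p`: a closed immersion whose kernel ideal is generated, on an
affine open neighbourhood `U = Spec A` of each point of the image, by a weakly regular sequence
`f₁, …, f_p ∈ A`). Let `η` be the generic point of `Z`, `x = i(η)`, `𝔭 ⊂ A` the prime of `x` and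
`I = (f₁, …, f_p) = ker|_U`. Then

* `I ≤ 𝔭` (`x` lies in the support of the kernel ideal sheaf, Mathlib
  `Scheme.Hom.range_subset_ker_support`), and `𝔭` is a MINIMAL prime of `I`: a prime `I ≤ 𝔮 ≤ 𝔭`
  is the prime of a point `y ∈ V(I) ∩ U = i(Z) ∩ U` (the support of the kernel of the quasi-compact `i`
  is the closure of its image, Mathlib `Scheme.Hom.support_ker`, and the image is closed) with `y ⤳ x`;
  as `i` is a closed embedding, `y = i(z')` with `z' ⤳ η`, so `z' = η` (`η` is generic, schemes are
  `T₀`) and `𝔮 = 𝔭`;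
* hence `ht 𝔭 ≤ p` by Krull's height theorem (Mathlib
  `Ideal.height_le_card_of_mem_minimalPrimes_span_finset`), and `ht 𝔭 ≥ p` because `f₁, …, f_p` stay a
  REGULAR sequence in the Noetherian local ring `A_𝔭` (flat base change, all `fᵢ ∈ 𝔭`; Mathlib
  `RingTheory.Sequence.IsWeaklyRegular.isRegular_of_isLocalization_of_mem`), where
  `dim A_𝔭 ⧸ (f) + p = dim A_𝔭 = ht 𝔭` (Mathlib `ringKrullDim_add_length_eq_ringKrullDim_of_isRegular`,
  `IsLocalization.AtPrime.ringKrullDim_eq_height`);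
* finally `codim x := Order.coheight x = ht 𝔭` (Mathlib `AlgebraicGeometry.idealHeight_eq_coheight`,
  `coheight_eq_of_isOpenImmersion` for `Spec A → X`).

## Main results

* `height_eq_length_of_isWeaklyRegular_of_mem_minimalPrimes` — the commutative-algebra core: in a
  Noetherian ring a minimal prime of the ideal of a weakly regular sequence of length `p` contained in
  it has height exactly `p`.
* `coheight_base_genericPoint_eq_of_isRegularImmersionOfCodim` — the scheme statement at the generic
  point.
* `stub_codimOfRegularImmersion` — the registered stub, VERBATIM.

## References

* [Matsumura1987] H. Matsumura, Commutative Ring Theory (1986), Thm. 13.5 (Krull), Thm. 17.4.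
* [GortzWedhorn2023] U. Görtz, T. Wedhorn, Algebraic Geometry II (2023), Def. 19.19, Def. 19.23.
-/

noncomputable section

-- `Summit.HodgeConjecture.HodgeConjecture.…` is the mandated namespace (single-conjunct summit).
set_option linter.dupNamespace false

namespace Summit.HodgeConjecture.HodgeConjecture.Theorems

open CategoryTheory AlgebraicGeometry Opposite TopologicalSpace Topology
open Literature.AlgebraicGeometry.HodgeTheory

universe u

/-- **Height of a minimal prime of a regular-sequence ideal** (Matsumura, Thm. 17.4 with Krull's
height theorem, Thm. 13.5). In a Noetherian ring `A`, if `f₁, …, f_p` is a weakly regular sequence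
and `𝔭` is a minimal prime of `(f₁, …, f_p)`, then `ht 𝔭 = p`: `≤` is Krull's height theorem; `≥`
holds because the `fᵢ ∈ 𝔭` form a regular sequence in the Noetherian local ring `A_𝔭`, where
`dim A_𝔭 ⧸ (f) + p = dim A_𝔭 = ht 𝔭`. [cite: Matsumura1987, Thm. 13.5 and Thm. 17.4] -/
theorem height_eq_length_of_isWeaklyRegular_of_mem_minimalPrimes {A : Type*} [CommRing A]
    [IsNoetherianRing A] (rs : List A) (hreg : RingTheory.Sequence.IsWeaklyRegular A rs)
    {𝔭 : Ideal A} [𝔭.IsPrime] (hmin : 𝔭 ∈ (Ideal.ofList rs).minimalPrimes) :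
    𝔭.height = rs.length := by
  classical
  apply le_antisymm
  · -- Krull's height theorem
    have h1 : 𝔭 ∈ (Ideal.span (rs.toFinset : Set A)).minimalPrimes := by
      rwa [List.coe_toFinset]
    refine (Ideal.height_le_card_of_mem_minimalPrimes_span_finset h1).trans ?_
    exact_mod_cast List.toFinset_card_le (l := rs)
  · -- the sequence stays regular in the localisation `A_𝔭`
    have hmem : ∀ r ∈ rs, r ∈ 𝔭 := fun r hr ↦ hmin.1.2 (Ideal.subset_span hr)
    have hreg' := hreg.isRegular_of_isLocalization_of_mem (Localization.AtPrime 𝔭) 𝔭 hmem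
    have hdim := ringKrullDim_add_length_eq_ringKrullDim_of_isRegular _ hreg'
    rw [List.length_map, IsLocalization.AtPrime.ringKrullDim_eq_height 𝔭 (Localization.AtPrime 𝔭)]
      at hdim
    -- the quotient is non-trivial, so its dimension is `≥ 0`
    have hne : Ideal.ofList (rs.map (algebraMap A (Localization.AtPrime 𝔭))) ≠ ⊤ := by
      intro h
      apply hreg'.top_ne_smul
      rw [h, Ideal.smul_eq_mul, Ideal.top_mul]
    haveI : Nontrivial (Localization.AtPrime 𝔭 ⧸
        Ideal.ofList (rs.map (algebraMap A (Localization.AtPrime 𝔭)))) :=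
      Ideal.Quotient.nontrivial_iff.mpr hne
    have h0 : (0 : WithBot ℕ∞) ≤ ringKrullDim (Localization.AtPrime 𝔭 ⧸
        Ideal.ofList (rs.map (algebraMap A (Localization.AtPrime 𝔭)))) :=
      ringKrullDim_nonneg_of_nontrivial
    obtain ⟨d, hd⟩ := WithBot.ne_bot_iff_exists.mp (ne_bot_of_le_ne_bot WithBot.coe_ne_bot h0)
    rw [← hd, ← WithBot.coe_natCast, ← WithBot.coe_add, WithBot.coe_inj] at hdim
    rw [← hdim]
    exact le_add_self

/-- **The generic point of an integral regular immersion of codimension `p` has codimension `p`.**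
For `X` locally Noetherian, `Z` integral with generic point `η` and `i : Z ⟶ X` a regular immersion of
codimension `p` (closed immersion, kernel ideal locally generated by a weakly regular sequence of
length `p`), `codim i(η) := Order.coheight (i η) = p`: in an affine chart `U = Spec A ∋ i(η)` with
`ker|_U = (f₁, …, f_p)`, the prime `𝔭` of `i(η)` is a minimal prime of `(f₁, …, f_p)` (the zero locus
of the kernel is the image, which is irreducible with generic point `i(η)`), so `ht 𝔭 = p`
(`height_eq_length_of_isWeaklyRegular_of_mem_minimalPrimes`), and `coheight i(η) = ht 𝔭`.
[cite: Matsumura1987, Thm. 13.5 and Thm. 17.4] [cite: GortzWedhorn2023, Def. 19.19 and Def. 19.23] -/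
theorem coheight_base_genericPoint_eq_of_isRegularImmersionOfCodim {X Z : Scheme.{u}} (i : Z ⟶ X)
    (p : ℕ) [IsLocallyNoetherian X] [AlgebraicGeometry.IsIntegral Z]
    (h : IsRegularImmersionOfCodim i p) :
    Order.coheight (i.base (genericPoint Z)) = (p : ℕ∞) := by
  classical
  haveI : IsClosedImmersion i := h.isClosedImmersion
  obtain ⟨U, hxU, rs, hlen, hreg, hI⟩ := h.2 (genericPoint Z)
  have hU : IsAffineOpen (U : X.Opens) := U.2
  haveI : IsNoetherianRing Γ(X, U) := IsLocallyNoetherian.component_noetherian U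
  -- the support of the kernel ideal, read in the chart `U`
  have hsupp : ∀ {y : X} (hy : y ∈ (U : X.Opens)),
      y ∈ i.ker.support ↔ ((i.ker.ideal U : Set Γ(X, U)) ⊆ (hU.primeIdealOf ⟨y, hy⟩).asIdeal) := by
    intro y hy
    have key := Set.ext_iff.mp (hU.fromSpec_preimage_zeroLocus (i.ker.ideal U : Set Γ(X, U)))
      (hU.primeIdealOf ⟨y, hy⟩)
    simp only [Set.mem_preimage, hU.fromSpec_primeIdealOf] at key
    rw [Scheme.IdealSheafData.mem_support_iff_of_mem (U := U) hy]
    exact key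
  -- the support of the kernel is the (closed) image
  have hrange : (i.ker.support : Set X) = Set.range i.base := by
    rw [Scheme.Hom.support_ker]
    exact i.isClosedEmbedding.isClosed_range.closure_eq
  -- the prime `𝔭` of `x = i(η)` contains `I = (rs) = ker|_U`
  have hIp : Ideal.ofList rs ≤ (hU.primeIdealOf ⟨i.base (genericPoint Z), hxU⟩).asIdeal := by
    rw [hI]
    have hxs : i.base (genericPoint Z) ∈ (i.ker.support : Set X) := hrange ▸ ⟨genericPoint Z, rfl⟩
    exact fun f hf ↦ (hsupp hxU).mp hxs hf
  -- and is minimal over it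
  have hmin : (hU.primeIdealOf ⟨i.base (genericPoint Z), hxU⟩).asIdeal ∈
      (Ideal.ofList rs).minimalPrimes := by
    refine ⟨⟨inferInstance, hIp⟩, fun 𝔮 h𝔮 h𝔮𝔭 ↦ ?_⟩
    obtain ⟨h𝔮prime, hI𝔮⟩ := h𝔮
    let q : PrimeSpectrum Γ(X, U) := ⟨𝔮, h𝔮prime⟩
    -- the point `y` of `𝔮` lies in `U`, in the image of `i`, and specialises to `x`
    have hyU : hU.fromSpec.base q ∈ (U : X.Opens) := hU.range_fromSpec.le ⟨q, rfl⟩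
    have hq : hU.primeIdealOf ⟨hU.fromSpec.base q, hyU⟩ = q :=
      hU.fromSpec.isOpenEmbedding.injective (hU.fromSpec_primeIdealOf ⟨hU.fromSpec.base q, hyU⟩)
    have hy : hU.fromSpec.base q ∈ (i.ker.support : Set X) := by
      refine (hsupp hyU).mpr ?_
      rw [hq, ← hI]
      exact hI𝔮
    rw [hrange] at hy
    obtain ⟨z', hz'⟩ := hy
    have hspec : hU.fromSpec.base q ⤳ i.base (genericPoint Z) := by
      have := (Literature.AlgebraicGeometry.Dimension.Scheme.fromSpec_specializes_iff hU q
        (hU.primeIdealOf ⟨i.base (genericPoint Z), hxU⟩)).mpr h𝔮𝔭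
      rwa [hU.fromSpec_primeIdealOf] at this
    rw [← hz', i.isClosedEmbedding.isInducing.specializes_iff] at hspec
    -- `η` is generic, so `z' = η`
    have hz'η : z' = genericPoint Z :=
      (hspec.antisymm (genericPoint_specializes z')).eq
    subst hz'η
    -- hence `𝔮 = 𝔭`
    have : q = hU.primeIdealOf ⟨i.base (genericPoint Z), hxU⟩ := by
      rw [← hq]
      congr 1
      exact Subtype.ext hz'.symm
    exact le_of_eq (congrArg PrimeSpectrum.asIdeal this).symm
  -- conclude: `coheight x = ht 𝔭 = p`
  have hx : hU.fromSpec.base (hU.primeIdealOf ⟨i.base (genericPoint Z), hxU⟩) =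
      i.base (genericPoint Z) :=
    hU.fromSpec_primeIdealOf ⟨_, hxU⟩
  rw [← hx, AlgebraicGeometry.coheight_eq_of_isOpenImmersion hU.fromSpec,
    ← AlgebraicGeometry.idealHeight_eq_coheight,
    height_eq_length_of_isWeaklyRegular_of_mem_minimalPrimes rs hreg hmin, hlen]

/-- **Registered stub `stub_codimOfRegularImmersion`** of the line `bloch-lifts-fulton` (crux
`BlochSpreadEightFour`, stmt-HodgeConjecture-18884), VERBATIM: an integral closed subscheme which is a
regular immersion of codimension `p` into a locally Noetherian scheme has a point (its generic point)
of codimension exactly `p`. [cite: Matsumura1987, Thm. 13.5 and Thm. 17.4] -/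
theorem stub_codimOfRegularImmersion :
    ∀ {X Z : Scheme.{0}} (i : Z ⟶ X) (p : ℕ) [IsLocallyNoetherian X] [AlgebraicGeometry.IsIntegral Z],
      IsRegularImmersionOfCodim i p → ∃ z : Z, Order.coheight (i.base z) = (p : ℕ∞) :=
  fun i p _ _ h ↦ ⟨genericPoint _, coheight_base_genericPoint_eq_of_isRegularImmersionOfCodim i p h⟩

end Summit.HodgeConjecture.HodgeConjecture.Theorems

end
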